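import Mathlib
import Summits.NavierStokesRegularity.NavierStokesRegularity.Theorems.FilamentSkeletonRssKelvinGatePressureDecay

/-!
# Route `FilamentSkeletonRss` · crux `TransverseReductionRJ` (stmt-NavierStokesRegularity-21221) — line `kelvin_gate`,
# stub S2′ `EventualKelvinGate`: the FREE PRESSURE is `C¹` — `D(T_a f) = T_a(Df)` on `⟨y⟩⁻²`-decaying `C¹` densities

Helper file (theorems only, `--supports stmt-NavierStokesRegularity-21221 --as helper`).  HONEST FRAMING: analysis
bookkeeping for a HYPOTHETICAL filament-type rotating-self-similar blow-up route; nothing here bears on Navier–Stokes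
regularity; no stub is proved here.

Continuation of `…KelvinGatePressureDecay` (the weighted dipole integral `∫|x−y|⁻²(1+|y|)⁻²dy ≤ 12V/(1+|x|)`).  For the
dipole potential `T_a g(x) = ∫ ∂ₐΓ(x − y) • g(y) dy` (`newtonGradPotential`) of a density with `(1+|y|)² ‖g‖ ≤ R`
(values in any real Banach space — the gate needs `g = F_j` AND `g = DF_j`):

* `norm_newtonGradPotential_le_of_sq_weight` — `‖T_a g(x)‖ ≤ (‖a‖R/4π) · 12V/(1+|x|)`;
* `continuous_newtonGradPotential_of_sq_weight` — `T_a g` is continuous for continuous `g` (dominated convergence);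
* `hasFDerivAt_newtonGradPotential_of_sq_weight` — **`D(T_a f)(x) = T_a(Df)(x)`** for `f ∈ C¹` with
  `(1+|y|)²‖f‖ ≤ R₀`, `(1+|y|)²‖Df‖ ≤ R₁` (write `T_a f(x) = ∫ ∂ₐΓ(z) f(x − z) dz` and differentiate under the integral,
  dominated on `B(x,1)` by `4 (‖a‖R₁/4π) |z|⁻² (1+|x − z|)⁻²`; Gilbarg–Trudinger Lemma 4.1 with the derivative on the
  density — NO Calderón–Zygmund theory, which is why `C¹` data suffice);
* `contDiff_one_newtonGradPotential_of_sq_weight`, `norm_fderiv_newtonGradPotential_le_of_sq_weight` — hence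
  `T_a f ∈ C¹` with `‖D(T_a f)(x)‖ ≤ (‖a‖R₁/4π) · 12V/(1+|x|)`.

Consequence for the free Kelvin gate (evidence #28, route R1 (P1)): for `F ∈ Y` the free pressure `Q = Σⱼ T_{eⱼ} Fⱼ` is
`C¹`, bounded, `|Q| + |∇Q| ≤ C R/(1+|y|)` — the GateSpec pressure clause at `U⁰ = 0` — and `F − ∇Q ∈ C⁰` with the
`⟨y⟩⁻¹` bound (its divergence-freeness, `ΔQ = div F`, is Gilbarg–Trudinger Lemma 4.2 and is not in this file).
-/

set_option linter.dupNamespace false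

noncomputable section

namespace Summit.NavierStokesRegularity.NavierStokesRegularity.Theorems.KelvinGate

open Set Function Filter MeasureTheory Metric Real
open Literature.Analysis.FluidPDE Literature.Analysis.FluidPDE.NewtonPotentialHolder
open scoped ENNReal Topology

section Banach

variable {G : Type*} [NormedAddCommGroup G] [NormedSpace ℝ G]

/-- Pointwise bound of the dipole integrand off the pole (Banach-valued density):
`‖∂ₐΓ(x − y) • g(y)‖ ≤ (‖a‖R/4π) |x − y|⁻² (1+|y|)⁻²` when `(1+|y|)²‖g(y)‖ ≤ R`, `y ≠ x`. -/
theorem norm_fderiv_newtonKernel_smul_le_of_sq_weight {g : EuclideanSpace ℝ (Fin 3) → G} {R : ℝ}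
    (hg : ∀ y, (1 + ‖y‖) ^ 2 * ‖g y‖ ≤ R) (a : EuclideanSpace ℝ (Fin 3)) {x y : EuclideanSpace ℝ (Fin 3)} (hxy : y ≠ x) :
    ‖fderiv ℝ newtonKernel (x - y) a • g y‖ ≤ ‖a‖ * R / (4 * π) * (‖x - y‖ ^ (-(2:ℝ)) * ((1 + ‖y‖) ^ 2)⁻¹) := by
  have hne : x - y ≠ 0 := sub_ne_zero.2 (Ne.symm hxy)
  have hpos : 0 < ‖x - y‖ := norm_pos_iff.2 hne
  have hw : 0 < (1 + ‖y‖) ^ 2 := by positivity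
  have hgy : ‖g y‖ ≤ R * ((1 + ‖y‖) ^ 2)⁻¹ := by
    rw [← div_eq_mul_inv, le_div_iff₀ hw, mul_comm]; exact hg y
  have hK : ‖fderiv ℝ newtonKernel (x - y) a‖ ≤ (4 * π * ‖x - y‖ ^ 2)⁻¹ * ‖a‖ := by
    rw [← norm_fderiv_newtonKernel hne]; exact ContinuousLinearMap.le_opNorm _ _
  rw [norm_smul, rpow_neg hpos.le, rpow_two]
  calc ‖fderiv ℝ newtonKernel (x - y) a‖ * ‖g y‖
      ≤ (4 * π * ‖x - y‖ ^ 2)⁻¹ * ‖a‖ * (R * ((1 + ‖y‖) ^ 2)⁻¹) :=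
        mul_le_mul hK hgy (norm_nonneg _) (by positivity)
    _ = ‖a‖ * R / (4 * π) * ((‖x - y‖ ^ 2)⁻¹ * ((1 + ‖y‖) ^ 2)⁻¹) := by
        field_simp

/-- Absolute convergence of the dipole potential of a `⟨y⟩⁻²` density (Banach-valued). -/
theorem integrable_fderiv_newtonKernel_smul_of_sq_weight {g : EuclideanSpace ℝ (Fin 3) → G}
    (hgm : AEStronglyMeasurable g (volume : Measure (EuclideanSpace ℝ (Fin 3)))) {R : ℝ}
    (hg : ∀ y, (1 + ‖y‖) ^ 2 * ‖g y‖ ≤ R) (a x : EuclideanSpace ℝ (Fin 3)) :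
    Integrable (fun y => fderiv ℝ newtonKernel (x - y) a • g y) (volume : Measure (EuclideanSpace ℝ (Fin 3))) := by
  have hb := (integral_norm_sub_rpow_neg_two_mul_inv_weight_sq_le x).1
  refine Integrable.mono' (hb.const_mul (‖a‖ * R / (4 * π))) ?_ ?_
  · refine AEStronglyMeasurable.smul ?_ hgm
    exact ((measurable_fderiv_apply_const ℝ newtonKernel a).comp
      (measurable_const.sub measurable_id)).aestronglyMeasurable
  · have h0 : (volume : Measure (EuclideanSpace ℝ (Fin 3))) {x} = 0 := measure_singleton x
    filter_upwards [compl_mem_ae_iff.2 h0] with y hy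
    have hyx : y ≠ x := by simpa using hy
    exact norm_fderiv_newtonKernel_smul_le_of_sq_weight hg a hyx

/-- **`‖T_a g(x)‖ ≤ (‖a‖R/4π) · 12V/(1+|x|)`** for a density with `(1+|y|)²‖g(y)‖ ≤ R` (`V = 3|B₁|`). -/
theorem norm_newtonGradPotential_le_of_sq_weight {g : EuclideanSpace ℝ (Fin 3) → G} {R : ℝ}
    (hg : ∀ y, (1 + ‖y‖) ^ 2 * ‖g y‖ ≤ R) (a x : EuclideanSpace ℝ (Fin 3)) :
    ‖newtonGradPotential a g x‖ ≤
      ‖a‖ * R / (4 * π) * (12 * (3 * (volume : Measure (EuclideanSpace ℝ (Fin 3))).real (ball 0 1)) / (1 + ‖x‖)) := by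
  have hR : 0 ≤ R := le_trans (by positivity) (hg 0)
  obtain ⟨hb, hI⟩ := integral_norm_sub_rpow_neg_two_mul_inv_weight_sq_le x
  have h0 : (volume : Measure (EuclideanSpace ℝ (Fin 3))) {x} = 0 := measure_singleton x
  have hbound : ∀ᵐ y ∂(volume : Measure (EuclideanSpace ℝ (Fin 3))),
      ‖fderiv ℝ newtonKernel (x - y) a • g y‖ ≤ ‖a‖ * R / (4 * π) * (‖x - y‖ ^ (-(2:ℝ)) * ((1 + ‖y‖) ^ 2)⁻¹) := by
    filter_upwards [compl_mem_ae_iff.2 h0] with y hy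
    have hyx : y ≠ x := by simpa using hy
    exact norm_fderiv_newtonKernel_smul_le_of_sq_weight hg a hyx
  unfold newtonGradPotential
  calc ‖∫ y, fderiv ℝ newtonKernel (x - y) a • g y‖
      ≤ ∫ y, ‖a‖ * R / (4 * π) * (‖x - y‖ ^ (-(2:ℝ)) * ((1 + ‖y‖) ^ 2)⁻¹) :=
        norm_integral_le_of_norm_le (hb.const_mul _) hbound
    _ = ‖a‖ * R / (4 * π) * ∫ y, ‖x - y‖ ^ (-(2:ℝ)) * ((1 + ‖y‖) ^ 2)⁻¹ := integral_const_mul _ _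
    _ ≤ ‖a‖ * R / (4 * π) * (12 * (3 * (volume : Measure (EuclideanSpace ℝ (Fin 3))).real (ball 0 1)) / (1 + ‖x‖)) :=
        mul_le_mul_of_nonneg_left hI (by positivity)

/-- Change of variables: `T_a g(x) = ∫ ∂ₐΓ(z) • g(x − z) dz` for every density. -/
theorem newtonGradPotential_eq_integral_comp_sub (a : EuclideanSpace ℝ (Fin 3)) (g : EuclideanSpace ℝ (Fin 3) → G)
    (x : EuclideanSpace ℝ (Fin 3)) :
    newtonGradPotential a g x = ∫ z, fderiv ℝ newtonKernel z a • g (x - z) := by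
  rw [newtonGradPotential]
  have e : (fun y => fderiv ℝ newtonKernel (x - y) a • g y) =
      fun y => fderiv ℝ newtonKernel (x - y) a • g (x - (x - y)) := by
    funext y; rw [sub_sub_cancel]
  rw [e]
  exact integral_sub_left_eq_self (fun z => fderiv ℝ newtonKernel z a • g (x - z)) volume x

/-- The near-ball weight comparison: for `‖x′ − x‖ < 1`, `(1+|x′ − z|)⁻² ≤ 4 (1+|x − z|)⁻²`. -/
theorem inv_weight_sq_comp_sub_le_of_mem_ball {x x' : EuclideanSpace ℝ (Fin 3)} (hx' : x' ∈ ball x 1)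
    (z : EuclideanSpace ℝ (Fin 3)) :
    ((1 + ‖x' - z‖) ^ 2)⁻¹ ≤ 4 * ((1 + ‖x - z‖) ^ 2)⁻¹ := by
  rw [mem_ball, dist_eq_norm] at hx'
  have h1 : ‖x - z‖ ≤ ‖x - x'‖ + ‖x' - z‖ := by
    calc ‖x - z‖ = ‖(x - x') + (x' - z)‖ := by rw [sub_add_sub_cancel]
      _ ≤ ‖x - x'‖ + ‖x' - z‖ := norm_add_le _ _
  have h2 : 1 + ‖x - z‖ ≤ 2 * (1 + ‖x' - z‖) := by
    rw [norm_sub_rev x x'] at h1; linarith [norm_nonneg (x' - z)]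
  have h3 : 0 < 1 + ‖x' - z‖ := by linarith [norm_nonneg (x' - z)]
  rw [show 4 * ((1 + ‖x - z‖) ^ 2)⁻¹ = (((1 + ‖x - z‖) / 2) ^ 2)⁻¹ by field_simp; ring]
  exact inv_anti₀ (by positivity) (pow_le_pow_left₀ (by positivity) (by linarith) 2)

/-- The dominating function of the dipole integrand near `x`: for `x′ ∈ B(x,1)`, `z ≠ 0`,
`‖∂ₐΓ(z) • g(x′ − z)‖ ≤ 4 (‖a‖R/4π) |x − (x − z)|⁻² (1+|x − z|)⁻²` when `(1+|y|)²‖g‖ ≤ R`. -/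
theorem norm_fderiv_newtonKernel_smul_comp_sub_le_of_sq_weight {g : EuclideanSpace ℝ (Fin 3) → G} {R : ℝ}
    (hg : ∀ y, (1 + ‖y‖) ^ 2 * ‖g y‖ ≤ R) (a : EuclideanSpace ℝ (Fin 3)) {x x' z : EuclideanSpace ℝ (Fin 3)}
    (hx' : x' ∈ ball x 1) (hz : z ≠ 0) :
    ‖fderiv ℝ newtonKernel z a • g (x' - z)‖ ≤
      4 * (‖a‖ * R / (4 * π)) * (‖x - (x - z)‖ ^ (-(2:ℝ)) * ((1 + ‖x - z‖) ^ 2)⁻¹) := by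
  have hR : 0 ≤ R := le_trans (by positivity) (hg 0)
  have hne : x' - z ≠ x' := by rw [Ne, sub_eq_self]; exact hz
  have h := norm_fderiv_newtonKernel_smul_le_of_sq_weight hg a (x := x') (y := x' - z) hne
  rw [sub_sub_cancel] at h
  rw [sub_sub_cancel]
  calc ‖fderiv ℝ newtonKernel z a • g (x' - z)‖
      ≤ ‖a‖ * R / (4 * π) * (‖z‖ ^ (-(2:ℝ)) * ((1 + ‖x' - z‖) ^ 2)⁻¹) := h
    _ ≤ ‖a‖ * R / (4 * π) * (‖z‖ ^ (-(2:ℝ)) * (4 * ((1 + ‖x - z‖) ^ 2)⁻¹)) := by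
        gcongr
        exact inv_weight_sq_comp_sub_le_of_mem_ball hx' z
    _ = 4 * (‖a‖ * R / (4 * π)) * (‖z‖ ^ (-(2:ℝ)) * ((1 + ‖x - z‖) ^ 2)⁻¹) := by ring

/-- The dominating function is integrable (it is a translate of the weighted dipole integrand of `…PressureDecay`). -/
theorem integrable_dominator_comp_sub (c : ℝ) (x : EuclideanSpace ℝ (Fin 3)) :
    Integrable (fun z => c * (‖x - (x - z)‖ ^ (-(2:ℝ)) * ((1 + ‖x - z‖) ^ 2)⁻¹))
      (volume : Measure (EuclideanSpace ℝ (Fin 3))) :=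
  (((integral_norm_sub_rpow_neg_two_mul_inv_weight_sq_le x).1).comp_sub_left x).const_mul c

/-- `∀ᵐ z, z ≠ 0` for Lebesgue measure on `ℝ³`. -/
theorem ae_ne_zero_volume : ∀ᵐ z ∂(volume : Measure (EuclideanSpace ℝ (Fin 3))), z ≠ 0 := by
  have h0 : (volume : Measure (EuclideanSpace ℝ (Fin 3))) {0} = 0 := measure_singleton 0
  filter_upwards [compl_mem_ae_iff.2 h0] with y hy
  simpa using hy

/-- **`T_a g` is continuous** for a continuous density with `(1+|y|)²‖g‖ ≤ R` (dominated convergence in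
`T_a g(x′) = ∫ ∂ₐΓ(z) • g(x′ − z) dz`). -/
theorem continuous_newtonGradPotential_of_sq_weight [CompleteSpace G] {g : EuclideanSpace ℝ (Fin 3) → G}
    (hgc : Continuous g) {R : ℝ} (hg : ∀ y, (1 + ‖y‖) ^ 2 * ‖g y‖ ≤ R) (a : EuclideanSpace ℝ (Fin 3)) :
    Continuous (newtonGradPotential a g) := by
  have hk : Measurable fun z : EuclideanSpace ℝ (Fin 3) => fderiv ℝ newtonKernel z a :=
    measurable_fderiv_apply_const ℝ newtonKernel a
  have hfun : newtonGradPotential a g = fun x => ∫ z, fderiv ℝ newtonKernel z a • g (x - z) :=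
    funext fun x => newtonGradPotential_eq_integral_comp_sub a g x
  rw [hfun]
  refine continuous_iff_continuousAt.2 fun x => ?_
  refine continuousAt_of_dominated (bound := fun z => 4 * (‖a‖ * R / (4 * π)) *
      (‖x - (x - z)‖ ^ (-(2:ℝ)) * ((1 + ‖x - z‖) ^ 2)⁻¹)) ?_ ?_ (integrable_dominator_comp_sub _ x) ?_
  · exact Eventually.of_forall fun x' =>
      hk.aestronglyMeasurable.smul (hgc.comp (continuous_const.sub continuous_id)).aestronglyMeasurable
  · filter_upwards [ball_mem_nhds x one_pos] with x' hx'
    filter_upwards [ae_ne_zero_volume] with z hz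
    exact norm_fderiv_newtonKernel_smul_comp_sub_le_of_sq_weight hg a hx' hz
  · exact Eventually.of_forall fun z =>
      ((hgc.comp (continuous_id.sub continuous_const)).const_smul (fderiv ℝ newtonKernel z a)).continuousAt

/-- **`D(T_a f)(x) = T_a(Df)(x)`** for `f ∈ C¹` with `(1+|y|)²‖f‖ ≤ R₀` and `(1+|y|)²‖Df‖ ≤ R₁`: the dipole potential of a
`⟨y⟩⁻²`-decaying `C¹` density is differentiable and its derivative is the potential of the derivative
(Gilbarg–Trudinger Lemma 4.1 with the derivative on the density; no compact support). -/
theorem hasFDerivAt_newtonGradPotential_of_sq_weight [CompleteSpace G] {f : EuclideanSpace ℝ (Fin 3) → G}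
    (hf : ContDiff ℝ 1 f) {R₀ R₁ : ℝ} (h0 : ∀ y, (1 + ‖y‖) ^ 2 * ‖f y‖ ≤ R₀)
    (h1 : ∀ y, (1 + ‖y‖) ^ 2 * ‖fderiv ℝ f y‖ ≤ R₁) (a x : EuclideanSpace ℝ (Fin 3)) :
    HasFDerivAt (newtonGradPotential a f) (newtonGradPotential a (fderiv ℝ f) x) x := by
  have hfc : Continuous f := hf.continuous
  have hDf : Continuous (fderiv ℝ f) := hf.continuous_fderiv one_ne_zero
  have hk : Measurable fun z : EuclideanSpace ℝ (Fin 3) => fderiv ℝ newtonKernel z a :=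
    measurable_fderiv_apply_const ℝ newtonKernel a
  have hfun : newtonGradPotential a f = fun x => ∫ z, fderiv ℝ newtonKernel z a • f (x - z) :=
    funext fun x => newtonGradPotential_eq_integral_comp_sub a f x
  rw [hfun, newtonGradPotential_eq_integral_comp_sub a (fderiv ℝ f) x]
  refine hasFDerivAt_integral_of_dominated_of_fderiv_le
    (F' := fun x' z => fderiv ℝ newtonKernel z a • fderiv ℝ f (x' - z))
    (bound := fun z => 4 * (‖a‖ * R₁ / (4 * π)) * (‖x - (x - z)‖ ^ (-(2:ℝ)) * ((1 + ‖x - z‖) ^ 2)⁻¹))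
    (ball_mem_nhds x one_pos) ?_ ?_ ?_ ?_ (integrable_dominator_comp_sub _ x) ?_
  · exact Eventually.of_forall fun x' =>
      hk.aestronglyMeasurable.smul (hfc.comp (continuous_const.sub continuous_id)).aestronglyMeasurable
  · have h := (integrable_fderiv_newtonKernel_smul_of_sq_weight hfc.aestronglyMeasurable h0 a x).comp_sub_left x
    refine h.congr (Eventually.of_forall fun z => ?_)
    simp only [sub_sub_cancel]
  · exact hk.aestronglyMeasurable.smul (hDf.comp (continuous_const.sub continuous_id)).aestronglyMeasurable
  · filter_upwards [ae_ne_zero_volume] with z hz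
    intro x' hx'
    exact norm_fderiv_newtonKernel_smul_comp_sub_le_of_sq_weight h1 a hx' hz
  · refine Eventually.of_forall fun z x' _ => ?_
    have hd : HasFDerivAt (fun x'' : EuclideanSpace ℝ (Fin 3) => f (x'' - z)) (fderiv ℝ f (x' - z)) x' := by
      have := ((hf.differentiable one_ne_zero) (x' - z)).hasFDerivAt.comp x' (hasFDerivAt_sub_const z)
      rwa [ContinuousLinearMap.comp_id] at this
    exact hd.const_smul (fderiv ℝ newtonKernel z a)

/-- `D(T_a f) = T_a(Df)` as functions. -/
theorem fderiv_newtonGradPotential_of_sq_weight [CompleteSpace G] {f : EuclideanSpace ℝ (Fin 3) → G}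
    (hf : ContDiff ℝ 1 f) {R₀ R₁ : ℝ} (h0 : ∀ y, (1 + ‖y‖) ^ 2 * ‖f y‖ ≤ R₀)
    (h1 : ∀ y, (1 + ‖y‖) ^ 2 * ‖fderiv ℝ f y‖ ≤ R₁) (a : EuclideanSpace ℝ (Fin 3)) :
    fderiv ℝ (newtonGradPotential a f) = newtonGradPotential a (fderiv ℝ f) :=
  funext fun x => (hasFDerivAt_newtonGradPotential_of_sq_weight hf h0 h1 a x).fderiv

/-- **The free pressure is `C¹`**: `T_a f ∈ C¹` for `f ∈ C¹` with `(1+|y|)²‖f‖ ≤ R₀`, `(1+|y|)²‖Df‖ ≤ R₁`. -/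
theorem contDiff_one_newtonGradPotential_of_sq_weight [CompleteSpace G] {f : EuclideanSpace ℝ (Fin 3) → G}
    (hf : ContDiff ℝ 1 f) {R₀ R₁ : ℝ} (h0 : ∀ y, (1 + ‖y‖) ^ 2 * ‖f y‖ ≤ R₀)
    (h1 : ∀ y, (1 + ‖y‖) ^ 2 * ‖fderiv ℝ f y‖ ≤ R₁) (a : EuclideanSpace ℝ (Fin 3)) :
    ContDiff ℝ 1 (newtonGradPotential a f) := by
  rw [contDiff_one_iff_fderiv]
  refine ⟨fun x => (hasFDerivAt_newtonGradPotential_of_sq_weight hf h0 h1 a x).differentiableAt, ?_⟩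
  rw [fderiv_newtonGradPotential_of_sq_weight hf h0 h1 a]
  exact continuous_newtonGradPotential_of_sq_weight (hf.continuous_fderiv one_ne_zero) h1 a

/-- **Decay of the gradient of the free pressure**: `‖D(T_a f)(x)‖ ≤ (‖a‖R₁/4π) · 12V/(1+|x|)`. -/
theorem norm_fderiv_newtonGradPotential_le_of_sq_weight [CompleteSpace G] {f : EuclideanSpace ℝ (Fin 3) → G}
    (hf : ContDiff ℝ 1 f) {R₀ R₁ : ℝ} (h0 : ∀ y, (1 + ‖y‖) ^ 2 * ‖f y‖ ≤ R₀)
    (h1 : ∀ y, (1 + ‖y‖) ^ 2 * ‖fderiv ℝ f y‖ ≤ R₁) (a x : EuclideanSpace ℝ (Fin 3)) :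
    ‖fderiv ℝ (newtonGradPotential a f) x‖ ≤
      ‖a‖ * R₁ / (4 * π) * (12 * (3 * (volume : Measure (EuclideanSpace ℝ (Fin 3))).real (ball 0 1)) / (1 + ‖x‖)) := by
  rw [fderiv_newtonGradPotential_of_sq_weight hf h0 h1 a]
  exact norm_newtonGradPotential_le_of_sq_weight h1 a x

end Banach

end Summit.NavierStokesRegularity.NavierStokesRegularity.Theorems.KelvinGate

end
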